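import Mathlib.Analysis.Real.Pi.Bounds
import Literature.Geometry.DiscreteGeometry.KissingNodeTypes
import HarnessLib

/-!
# Corner bounds at a node of the contact graph of a kissing configuration
# (Hales 2012, Lemma 7 and Lemma 9: the remaining local inequalities) — proved

Topic `Literature/Geometry/DiscreteGeometry`; provefact item for `Hales2012_kissingTwelve` (sibling
of `FejesTothKissingTwelve.lean`, `KissingRigidity.lean`, `KissingNodeDegree.lean`,
`KissingNodeTypes.lean`).  Hales's proof of Fejes Tóth's kissing-twelve conjecture
(arXiv:1209.6043) ends with **Lemma 9**: of the eight hypermaps with tame contact (Lemma 8, a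
computer classification, [Hal12b] = `HalesFlyspeck2012`), only the FCC and the HCP contact
hypermaps are realised by a kissing configuration `V ∈ 𝒱` — "a geometrical argument eliminates
one of these cases and linear programming eliminates the other five".  The linear programs
[HalesFlyspeck2012, `contact.mod`, JKJNYAA] use, at every node, "1. The angles around each
node sum to `2π`. 2. Each angle of a triangle is `α₃`. 3. Each angle of each rhombus lies between
`α₄` and `β₄`. 4. The opposite angles of each rhombus are equal." (`KissingNodeTypes.lean`,
Part H, proves these at the nodes of type `(p, q, 0)`), and in addition two things that this file
supplies, so that the six exclusions can be carried out by hand in `TameContactGraphs.lean`: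

* **the corner-sum inequality at an arbitrary node** (`IsKissingConfig.corner_sum_le`, Part B):
  with `d = deg v` contacts, `p` triangle pairs and `q` rhombus pairs at `v`, `p + q ≤ d` and
  `p · α₃ + Σ_{rhombus pairs} cornerAngle + (d − p − q) · α₄ ≤ 2π` — Hales's
  "`p α₃ + q α₄ + r α₅ ≤ 2π`" from the proof of Lemma 7 (table (7): a corner of a face with
  `k ≥ 5` sides at `v` lies between two consecutive contacts of `v` that are not in contact, hence
  `≥ 2h₀` apart, and is `≥ α₅ = α₄ = arccos (1 − (2h₀)²/6)`), with the rhombus corners kept exact;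
  this is the row of the linear program at a node of a pentagon;
* **the two corner values of a rhombus** (`IsKissingConfig.cornerAngle_add_cornerAngle`,
  Part C): for a rhombus `v, u, x, w` of the contact graph the corner value
  `θ₁ = cornerAngle {u, w}` (at `v` and `x`) and `θ₂ = cornerAngle {v, x}` (at `u` and `w`) satisfy
  the identity `θ₁ + θ₂ = π + arccos ((7 + ⟪u, w⟫ + ⟪v, x⟫)/9)` (from `(4 + ⟪u,w⟫)(4 + ⟪v,x⟫) = 16`,
  the rhombus lemma of `KissingRigidity.lean`), whence `θ₁ + θ₂ ≥ π + 3/5`.  The linear programs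
  contain this information as the lower bound `sol ≥ 1.3085` on the area `2(θ₁ + θ₂) − 2π` of a
  quadrilateral (from the main estimate, Theorem 2, `τ ≥ d(4) = 0.206`); here it is elementary.
  (Only this quadrilateral bound, and not the pentagon bound of Theorem 2, is needed for the
  exclusions; see `TameContactGraphs.lean`.)

Part E adds the local fact behind the hexagon case of Lemma 9: across a node with three
consecutive triangles `{v,u,k}, {v,k,l}, {v,l,w}` one has `⟪u, w⟫ = 1 + 3 cos 3α₃ = −14/9`
(`IsKissingConfig.inner_eq_of_three_triangles`).  Part D collects the comparisons of constants
used by the certificates (`β₄ < 2α₃`, `α₃ < α₄`, `π/2 < α₄`, `3α₃ = π + arccos (23/27)`,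
`arccos (23/27) > 1/2`, `arccos c ≥ 3/5` for `c ≤ 0.82`), all reduced to `cos x ≥ 1 − x²/2` and
rational arithmetic in `h₀ = 1.26`.

## Contents (namespace `Literature.DiscreteGeom`)

* Part A: `arccos_le_of_cos_le`, `sum_le_of_sorted_three`, `sum_le_of_sorted_two`,
  `sum_le_of_sorted_four` (sorted tangent directions with unknown corners).
* Part B: `IsKissingConfig.corner_sum_le`.
* Part C: `cos_tangentAngle_add`, `tangentAngle_add_eq`, `three_fifths_le_arccos`,
  `IsKissingConfig.cornerAngle_add_cornerAngle`.
* Part D: `three_mul_arccos_third`, `one_half_lt_arccos`,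
  `arccos_kappa_lt_two_mul_arccos_third`, `arccos_third_lt_arccos_sigma`,
  `pi_div_two_lt_arccos_sigma`.
* Part E: `cos_add_add_eq_of_cos_eq_third`, `IsKissingConfig.inner_eq_of_three_triangles`.

## References

* T. C. Hales, *A proof of Fejes Tóth's conjecture on sphere packings with kissing number twelve*,
  arXiv:1209.6043 (2012): Lemma 7 and its proof (table (7)), p. 12; Lemma 9 and its proof (the
  four linear programming constraints; the hexagon case), p. 13 (`Hales2012`).
* T. C. Hales et al., *The Flyspeck project*, source code archive (2012), [Hal12b] of the paper:
  `projects_discrete_geom/fejestoth12/contact.mod` (the GLPK model, JKJNYAA)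
  (`HalesFlyspeck2012`).
-/

noncomputable section

namespace Literature.Geometry.DiscreteGeometry

open Real RealInnerProductSpace

/-! ### Part A. Sorted tangent directions with unknown corners -/

/-- A nonnegative gap whose cosine is at most `σ` is at least `arccos σ`. [folklore] -/
theorem arccos_le_of_cos_le {g σ : ℝ} (h0 : 0 ≤ g) (hc : cos g ≤ σ) : arccos σ ≤ g := by
  by_cases hπ : g ≤ π
  · calc arccos σ ≤ arccos (cos g) := arccos_le_arccos hc
      _ = g := arccos_cos h0 hπ
  · exact le_trans (arccos_le_pi σ) (le_of_not_ge hπ)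

/-- **Corner sum with unknown corners, three sorted directions.** The analogue of
`sum_le_of_sorted_four` for three directions `−π < t₀ < t₁ < t₂ ≤ π`: `|P| + |Q| ≤ 3` and
`|P| · arccos (1/3) + Σ_{z ∈ Q} F z + (3 − |P| − |Q|) · arccos σ ≤ 2π`.
[cite: Hales2012, Lemma 7 (proof) and Lemma 9 (proof, constraint 1)] -/
theorem sum_le_of_sorted_three {σ κ : ℝ} (hσ : σ < 0) (hκ : -7 / 9 < κ) (t : Fin 3 → ℝ)
    (hmono : StrictMono t) (hlo : -π < t 0) (hhi : t 2 ≤ π)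
    (hC : ∀ i j, i ≠ j → cos (t i - t j) = 1 / 3 ∨ cos (t i - t j) ≤ σ)
    (P Q : Set (Sym2 (Fin 3)))
    (hP : ∀ i j, s(i, j) ∈ P → i ≠ j ∧ cos (t i - t j) = 1 / 3)
    (hPall : ∀ i j, i ≠ j → cos (t i - t j) = 1 / 3 → s(i, j) ∈ P)
    (hQ : ∀ i j, s(i, j) ∈ Q → i ≠ j ∧ κ ≤ cos (t i - t j) ∧ cos (t i - t j) ≤ σ)
    (F : Sym2 (Fin 3) → ℝ)
    (hF : ∀ i j, s(i, j) ∈ Q → F s(i, j) = arccos (cos (t i - t j))) :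
    P.ncard + Q.ncard ≤ 3 ∧
      (P.ncard : ℝ) * arccos (1 / 3) + ∑ᶠ z ∈ Q, F z +
        (3 - P.ncard - Q.ncard : ℝ) * arccos σ ≤ 2 * π := by
  classical
  have hα1 := pi_div_three_lt_arccos_third
  have hα2 := arccos_third_lt_pi_div_two
  have hπ := pi_pos
  have h01 : t 0 < t 1 := hmono (by decide)
  have h12 : t 1 < t 2 := hmono (by decide)
  have hC' : ∀ i j, i ≠ j → cos (t i - t j) ≤ 1 / 3 := fun i j h => by
    rcases hC i j h with h' | h' <;> linarith
  -- the three gaps, each `≥ α`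
  have hg0 : arccos (1 / 3) ≤ t 1 - t 0 :=
    arccos_third_le_of_cos_le (by linarith) (hC' 1 0 (by decide))
  have hg1 : arccos (1 / 3) ≤ t 2 - t 1 :=
    arccos_third_le_of_cos_le (by linarith) (hC' 2 1 (by decide))
  have hcw : cos (2 * π - (t 2 - t 0)) = cos (t 2 - t 0) := cos_two_pi_sub _
  have hg2 : arccos (1 / 3) ≤ 2 * π - (t 2 - t 0) :=
    arccos_third_le_of_cos_le (by linarith) (by rw [hcw]; exact hC' 2 0 (by decide))
  -- a gap of cosine `> -7/9` is `≤ π`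
  have hle : ∀ x, arccos (1 / 3) ≤ x → x ≤ 2 * π - 2 * arccos (1 / 3) → -7 / 9 < cos x →
      x ≤ π := by
    intro x h1 h2 h3
    by_contra h
    have := cos_le_neg_seven_ninths (y := x) (by linarith) h2
    linarith
  -- all pairs are consecutive here
  set C : Finset (Sym2 (Fin 3)) := {s(0, 1), s(1, 2), s(0, 2)} with hCdef
  have hCcard : C.card = 3 := by rw [hCdef]; decide
  have hmemC : ∀ i j : Fin 3, i ≠ j → s(i, j) ∈ C := by
    intro i j hne
    fin_cases i <;> fin_cases j <;>
      simp only [Fin.zero_eta, Fin.mk_one, Fin.reduceFinMk] at hne ⊢ <;>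
      first
      | exact absurd rfl hne
      | (rw [hCdef]; decide)
  have hPC : P ⊆ ↑C := by
    intro z hz
    induction z using Sym2.ind with
    | h i j => exact hmemC i j (hP i j hz).1
  have hQC : Q ⊆ ↑C := by
    intro z hz
    induction z using Sym2.ind with
    | h i j => exact hmemC i j (hQ i j hz).1
  have hdisj : Disjoint P Q := by
    rw [Set.disjoint_left]
    intro z hzP hzQ
    induction z using Sym2.ind with
    | h i j =>
      obtain ⟨-, hcos⟩ := hP i j hzP
      obtain ⟨-, -, hle'⟩ := hQ i j hzQ
      linarith
  have hnotP : ∀ z ∈ Q, z ∉ P := fun z hzQ hzP => Set.disjoint_left.1 hdisj hzP hzQ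
  have hPfin : P.Finite := C.finite_toSet.subset hPC
  have hQfin : Q.Finite := C.finite_toSet.subset hQC
  have hle3 : P.ncard + Q.ncard ≤ 3 := by
    rw [← Set.ncard_union_eq hdisj hPfin hQfin]
    calc (P ∪ Q).ncard ≤ (↑C : Set (Sym2 (Fin 3))).ncard :=
          Set.ncard_le_ncard (Set.union_subset hPC hQC) C.finite_toSet
      _ = C.card := Set.ncard_coe_finset _
      _ = 3 := hCcard
  refine ⟨hle3, ?_⟩
  set c : Fin 3 → Sym2 (Fin 3) := ![s(0, 1), s(1, 2), s(0, 2)] with hcdef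
  set g : Fin 3 → ℝ := ![t 1 - t 0, t 2 - t 1, 2 * π - (t 2 - t 0)] with hgdef
  have hcC : ∀ z ∈ C, ∃ k, c k = z := by
    intro z hz
    simp only [hCdef, Finset.mem_insert, Finset.mem_singleton] at hz
    rcases hz with rfl | rfl | rfl
    exacts [⟨0, rfl⟩, ⟨1, rfl⟩, ⟨2, rfl⟩]
  have hcinj : Function.Injective c := by rw [hcdef]; decide
  have himage : ∀ R : Set (Sym2 (Fin 3)), R ⊆ ↑C →
      R = c '' ↑(Finset.univ.filter fun k => c k ∈ R) := by
    intro R hR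
    ext z
    constructor
    · intro hz
      obtain ⟨k, rfl⟩ := hcC z (hR hz)
      exact ⟨k, by simpa using hz, rfl⟩
    · rintro ⟨k, hk, rfl⟩
      simpa using hk
  have hPcount : P.ncard = (Finset.univ.filter fun k => c k ∈ P).card := by
    conv_lhs => rw [himage P hPC]
    rw [Set.ncard_image_of_injective _ hcinj, Set.ncard_coe_finset]
  have hQcount : Q.ncard = (Finset.univ.filter fun k => c k ∈ Q).card := by
    conv_lhs => rw [himage Q hQC]
    rw [Set.ncard_image_of_injective _ hcinj, Set.ncard_coe_finset]
  have hQsum : ∑ᶠ z ∈ Q, F z = ∑ k ∈ Finset.univ.filter (fun k => c k ∈ Q), F (c k) := by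
    conv_lhs => rw [himage Q hQC]
    rw [finsum_mem_image hcinj.injOn, finsum_mem_coe_finset]
  -- the gaps
  have hsum : g 0 + g 1 + g 2 = 2 * π := by
    simp only [hgdef, Matrix.cons_val_zero, Matrix.cons_val_one, Matrix.cons_val]
    ring
  have hglo : ∀ k, arccos (1 / 3) ≤ g k := by
    intro k
    fin_cases k <;>
      simp only [hgdef, Fin.zero_eta, Fin.mk_one, Fin.reduceFinMk, Matrix.cons_val_zero,
        Matrix.cons_val_one, Matrix.cons_val] <;> linarith
  have hghi : ∀ k, g k ≤ 2 * π - 2 * arccos (1 / 3) := by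
    intro k
    fin_cases k <;>
      simp only [hgdef, Fin.zero_eta, Fin.mk_one, Fin.reduceFinMk, Matrix.cons_val_zero,
        Matrix.cons_val_one, Matrix.cons_val] <;> linarith
  have hgpos : ∀ k, 0 ≤ g k := fun k => (arccos_nonneg _).trans (hglo k)
  have hgle : ∀ k, -7 / 9 < cos (g k) → g k ≤ π := fun k hk => hle _ (hglo k) (hghi k) hk
  have hgcos : ∀ k (i j : Fin 3), c k = s(i, j) → cos (t i - t j) = cos (g k) := by
    intro k i j hk
    fin_cases k <;>
      simp only [hcdef, hgdef, Fin.zero_eta, Fin.mk_one, Fin.reduceFinMk, Matrix.cons_val_zero,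
        Matrix.cons_val_one, Matrix.cons_val, Sym2.eq_iff] at hk ⊢
    · rcases hk with ⟨rfl, rfl⟩ | ⟨rfl, rfl⟩
      · exact cos_sub_rev _ _
      · rfl
    · rcases hk with ⟨rfl, rfl⟩ | ⟨rfl, rfl⟩
      · exact cos_sub_rev _ _
      · rfl
    · rw [hcw]
      rcases hk with ⟨rfl, rfl⟩ | ⟨rfl, rfl⟩
      · exact cos_sub_rev _ _
      · rfl
  have hcne : ∀ k (i j : Fin 3), c k = s(i, j) → i ≠ j := by
    intro k i j hk hij
    subst hij
    have : (c k).IsDiag := by rw [hk]; exact Sym2.mk_isDiag_iff.2 rfl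
    fin_cases k <;> simp [hcdef] at this
  have hkey : ∀ k, ∀ z : Sym2 (Fin 3), c k = z →
      (z ∈ P → g k = arccos (1 / 3)) ∧ (z ∈ Q → g k = F z) ∧ (z ∉ P → arccos σ ≤ g k) := by
    intro k z
    induction z using Sym2.ind with
    | h i j =>
      intro hz
      refine ⟨fun hk => ?_, fun hk => ?_, fun hk => ?_⟩
      · obtain ⟨-, hcos⟩ := hP i j hk
        rw [hgcos k i j hz] at hcos
        exact eq_arccos_third_of_cos_eq (hgpos k) (hgle k (by rw [hcos]; norm_num)) hcos
      · obtain ⟨-, hκ', -⟩ := hQ i j hk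
        rw [hgcos k i j hz] at hκ'
        rw [hF i j hk, hgcos k i j hz, arccos_cos (hgpos k) (hgle k (lt_of_lt_of_le hκ hκ'))]
      · have hne : i ≠ j := hcne k i j hz
        rcases hC i j hne with h | h
        · exact absurd (hPall i j hne h) hk
        · rw [hgcos k i j hz] at h
          exact arccos_le_of_cos_le (hgpos k) h
  -- pointwise lower bound `ℓ k ≤ g k`
  set ℓ : Fin 3 → ℝ := fun k =>
    if c k ∈ P then arccos (1 / 3) else if c k ∈ Q then F (c k) else arccos σ with hℓ
  have hℓle : ∀ k, ℓ k ≤ g k := by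
    intro k
    simp only [hℓ]
    split_ifs with h1 h2
    · exact ((hkey k _ rfl).1 h1).ge
    · exact ((hkey k _ rfl).2.1 h2).ge
    · exact (hkey k _ rfl).2.2 h1
  have htot : ∑ k, g k = 2 * π := by rw [Fin.sum_univ_three]; exact hsum
  have hsumle : ∑ k, ℓ k ≤ 2 * π := htot ▸ Finset.sum_le_sum fun k _ => hℓle k
  have hfiltQ : (Finset.univ.filter fun k => ¬c k ∈ P).filter (fun k => c k ∈ Q) =
      Finset.univ.filter fun k => c k ∈ Q := by
    ext k
    simp only [Finset.mem_filter, Finset.mem_univ, true_and]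
    exact ⟨fun h => h.2, fun h => ⟨hnotP _ h, h⟩⟩
  set n := ((Finset.univ.filter fun k => ¬c k ∈ P).filter fun k => ¬c k ∈ Q).card with hn
  have hcount : (Finset.univ.filter fun k => c k ∈ P).card +
      ((Finset.univ.filter fun k => c k ∈ Q).card + n) = 3 := by
    rw [hn, ← hfiltQ, Finset.card_filter_add_card_filter_not,
      Finset.card_filter_add_card_filter_not, Finset.card_univ, Fintype.card_fin]
  have hℓsum : ∑ k, ℓ k = (Finset.univ.filter fun k => c k ∈ P).card * arccos (1 / 3) +
      (∑ k ∈ Finset.univ.filter (fun k => c k ∈ Q), F (c k) + n * arccos σ) := by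
    simp only [hℓ]
    rw [Finset.sum_ite, Finset.sum_const, nsmul_eq_mul, Finset.sum_ite, hfiltQ, Finset.sum_const,
      nsmul_eq_mul]
  have hn' : (n : ℝ) = 3 - P.ncard - Q.ncard := by
    have h := congrArg (fun m : ℕ => (m : ℝ)) hcount
    push_cast at h
    rw [hPcount, hQcount]
    linarith
  rw [hℓsum, ← hPcount, ← hQsum, hn'] at hsumle
  linarith

/-- **Two directions.** With two contacts there is a single pair (at most one triangle or rhombus
pair), and `|P| · arccos (1/3) + Σ_{z ∈ Q} F z + (2 − |P| − |Q|) · arccos σ ≤ 2π` holds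
trivially (`F ≤ π` on `Q`). [cite: Hales2012, Lemma 7 (proof)] -/
theorem sum_le_of_sorted_two {σ : ℝ} (t : Fin 2 → ℝ) (P Q : Set (Sym2 (Fin 2)))
    (hP : ∀ i j, s(i, j) ∈ P → i ≠ j ∧ cos (t i - t j) = 1 / 3)
    (hQ : ∀ i j, s(i, j) ∈ Q → i ≠ j ∧ cos (t i - t j) ≤ σ) (hσ : σ < 1 / 3)
    (F : Sym2 (Fin 2) → ℝ) (hF : ∀ z ∈ Q, F z ≤ π) :
    P.ncard + Q.ncard ≤ 2 ∧
      (P.ncard : ℝ) * arccos (1 / 3) + ∑ᶠ z ∈ Q, F z +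
        (2 - P.ncard - Q.ncard : ℝ) * arccos σ ≤ 2 * π := by
  classical
  have hα2 := arccos_third_lt_pi_div_two
  have hπ := pi_pos
  have hσπ : arccos σ ≤ π := arccos_le_pi σ
  have hσ0 : 0 ≤ arccos σ := arccos_nonneg σ
  -- every non-diagonal pair is `s(0, 1)`
  have hpair : ∀ i j : Fin 2, i ≠ j → s(i, j) = s(0, 1) := by
    intro i j hne
    fin_cases i <;> fin_cases j <;> simp_all
  have hPsub : P ⊆ {s(0, 1)} := by
    intro z hz
    induction z using Sym2.ind with
    | h i j => exact hpair i j (hP i j hz).1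
  have hQsub : Q ⊆ {s(0, 1)} := by
    intro z hz
    induction z using Sym2.ind with
    | h i j => exact hpair i j (hQ i j hz).1
  have hdisj : Disjoint P Q := by
    rw [Set.disjoint_left]
    intro z hzP hzQ
    induction z using Sym2.ind with
    | h i j =>
      obtain ⟨-, hcos⟩ := hP i j hzP
      obtain ⟨-, hle⟩ := hQ i j hzQ
      linarith
  have hfin1 : ({s(0, 1)} : Set (Sym2 (Fin 2))).Finite := Set.finite_singleton _
  have hPfin : P.Finite := hfin1.subset hPsub
  have hQfin : Q.Finite := hfin1.subset hQsub
  have hle1 : P.ncard + Q.ncard ≤ 1 := by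
    rw [← Set.ncard_union_eq hdisj hPfin hQfin, ← Set.ncard_singleton (s((0 : Fin 2), (1 : Fin 2)))]
    exact Set.ncard_le_ncard (Set.union_subset hPsub hQsub) hfin1
  refine ⟨by omega, ?_⟩
  have hP1 : P.ncard ≤ 1 := by omega
  have hQ1 : Q.ncard ≤ 1 := by omega
  -- the `Q`-sum is at most `π`
  have hQs : ∑ᶠ z ∈ Q, F z ≤ Q.ncard * π := by
    rcases Nat.le_one_iff_eq_zero_or_eq_one.1 hQ1 with h | h
    · rw [Set.ncard_eq_zero hQfin] at h
      rw [h]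
      simp
    · obtain ⟨z, hz⟩ := Set.ncard_eq_one.1 h
      rw [h, hz, finsum_mem_singleton]
      simpa using hF z (by rw [hz]; exact Set.mem_singleton z)
  have hPr : (P.ncard : ℝ) ≤ 1 := by exact_mod_cast hP1
  have hQr : (Q.ncard : ℝ) ≤ 1 := by exact_mod_cast hQ1
  have hPQr : (P.ncard : ℝ) + Q.ncard ≤ 1 := by exact_mod_cast hle1
  have hP0 : (0 : ℝ) ≤ P.ncard := Nat.cast_nonneg _
  have hQ0 : (0 : ℝ) ≤ Q.ncard := Nat.cast_nonneg _
  nlinarith [hQs, arccos_nonneg (1 / 3 : ℝ), hσ0, hσπ]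

/-- **Corner sum with unknown corners, four sorted directions.** Let `−π < t₀ < t₁ < t₂ < t₃ ≤ π`
be four tangent directions at a node, any two a contact (`cos (tᵢ − tⱼ) = 1/3`) or separated
(`cos (tᵢ − tⱼ) ≤ σ < 0`); let `P` be the set of *all* contact pairs (triangle pairs) and `Q` a
set of rhombus pairs (`κ ≤ cos ≤ σ`, `κ > −7/9`).  Then `|P| + |Q| ≤ 4`, and — each of the
`4 − |P| − |Q|` remaining corners being the gap of a separated consecutive pair, `≥ arccos σ` —
`|P| · arccos (1/3) + Σ_{z ∈ Q} F z + (4 − |P| − |Q|) · arccos σ ≤ 2π` for any `F` with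
`F {i, j} = arccos (cos (tᵢ − tⱼ))` on `Q`.  (Hales: "`p α₃ + q α₄ + r α₅ ≤ 2π`", with the rhombus
corners kept exact.) [cite: Hales2012, Lemma 7 (proof) and Lemma 9 (proof, constraint 1)] -/
theorem sum_le_of_sorted_four {σ κ : ℝ} (hσ : σ < 0) (hκ : -7 / 9 < κ) (t : Fin 4 → ℝ)
    (hmono : StrictMono t) (hlo : -π < t 0) (hhi : t 3 ≤ π)
    (hC : ∀ i j, i ≠ j → cos (t i - t j) = 1 / 3 ∨ cos (t i - t j) ≤ σ)
    (P Q : Set (Sym2 (Fin 4)))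
    (hP : ∀ i j, s(i, j) ∈ P → i ≠ j ∧ cos (t i - t j) = 1 / 3)
    (hPall : ∀ i j, i ≠ j → cos (t i - t j) = 1 / 3 → s(i, j) ∈ P)
    (hQ : ∀ i j, s(i, j) ∈ Q → i ≠ j ∧ κ ≤ cos (t i - t j) ∧ cos (t i - t j) ≤ σ)
    (F : Sym2 (Fin 4) → ℝ)
    (hF : ∀ i j, s(i, j) ∈ Q → F s(i, j) = arccos (cos (t i - t j))) :
    P.ncard + Q.ncard ≤ 4 ∧
      (P.ncard : ℝ) * arccos (1 / 3) + ∑ᶠ z ∈ Q, F z +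
        (4 - P.ncard - Q.ncard : ℝ) * arccos σ ≤ 2 * π := by
  classical
  have hα1 := pi_div_three_lt_arccos_third
  have hα2 := arccos_third_lt_pi_div_two
  have hπ := pi_pos
  have h01 : t 0 < t 1 := hmono (by decide)
  have h12 : t 1 < t 2 := hmono (by decide)
  have h23 : t 2 < t 3 := hmono (by decide)
  have hC' : ∀ i j, i ≠ j → cos (t i - t j) ≤ 1 / 3 := fun i j h => by
    rcases hC i j h with h' | h' <;> linarith
  -- the four gaps (three consecutive, one wrap-around), each `≥ α = arccos (1/3)`
  have hg0 : arccos (1 / 3) ≤ t 1 - t 0 :=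
    arccos_third_le_of_cos_le (by linarith) (hC' 1 0 (by decide))
  have hg1 : arccos (1 / 3) ≤ t 2 - t 1 :=
    arccos_third_le_of_cos_le (by linarith) (hC' 2 1 (by decide))
  have hg2 : arccos (1 / 3) ≤ t 3 - t 2 :=
    arccos_third_le_of_cos_le (by linarith) (hC' 3 2 (by decide))
  have hcw : cos (2 * π - (t 3 - t 0)) = cos (t 3 - t 0) := cos_two_pi_sub _
  have hg3 : arccos (1 / 3) ≤ 2 * π - (t 3 - t 0) :=
    arccos_third_le_of_cos_le (by linarith) (by rw [hcw]; exact hC' 3 0 (by decide))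
  -- the diagonals `{0, 2}` and `{1, 3}` have cosine `≤ -7/9`
  have hd20 : cos (t 2 - t 0) ≤ -7 / 9 := cos_le_neg_seven_ninths (by linarith) (by linarith)
  have hd31 : cos (t 3 - t 1) ≤ -7 / 9 := cos_le_neg_seven_ninths (by linarith) (by linarith)
  have hd02 : cos (t 0 - t 2) ≤ -7 / 9 := by rw [cos_sub_rev]; exact hd20
  have hd13 : cos (t 1 - t 3) ≤ -7 / 9 := by rw [cos_sub_rev]; exact hd31
  -- hence `P` and `Q` consist of consecutive pairs
  set C : Finset (Sym2 (Fin 4)) := {s(0, 1), s(1, 2), s(2, 3), s(0, 3)} with hCdef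
  have hCcard : C.card = 4 := by rw [hCdef]; decide
  have hmemC : ∀ i j : Fin 4, i ≠ j → -7 / 9 < cos (t i - t j) → s(i, j) ∈ C := by
    intro i j hne hcos
    fin_cases i <;> fin_cases j <;>
      simp only [Fin.zero_eta, Fin.mk_one, Fin.reduceFinMk] at hne hcos ⊢ <;>
      first
      | exact absurd rfl hne
      | (exfalso; linarith)
      | (rw [hCdef]; decide)
  have hPC : P ⊆ ↑C := by
    intro z hz
    induction z using Sym2.ind with
    | h i j =>
      obtain ⟨hne, hcos⟩ := hP i j hz
      exact hmemC i j hne (by rw [hcos]; norm_num)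
  have hQC : Q ⊆ ↑C := by
    intro z hz
    induction z using Sym2.ind with
    | h i j =>
      obtain ⟨hne, hκ', -⟩ := hQ i j hz
      exact hmemC i j hne (lt_of_lt_of_le hκ hκ')
  have hdisj : Disjoint P Q := by
    rw [Set.disjoint_left]
    intro z hzP hzQ
    induction z using Sym2.ind with
    | h i j =>
      obtain ⟨-, hcos⟩ := hP i j hzP
      obtain ⟨-, -, hle⟩ := hQ i j hzQ
      linarith
  have hnotP : ∀ z ∈ Q, z ∉ P := fun z hzQ hzP => Set.disjoint_left.1 hdisj hzP hzQ
  have hPfin : P.Finite := C.finite_toSet.subset hPC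
  have hQfin : Q.Finite := C.finite_toSet.subset hQC
  have hle : P.ncard + Q.ncard ≤ 4 := by
    rw [← Set.ncard_union_eq hdisj hPfin hQfin]
    calc (P ∪ Q).ncard ≤ (↑C : Set (Sym2 (Fin 4))).ncard :=
          Set.ncard_le_ncard (Set.union_subset hPC hQC) C.finite_toSet
      _ = C.card := Set.ncard_coe_finset _
      _ = 4 := hCcard
  refine ⟨hle, ?_⟩
  -- index the consecutive pairs and the gaps by `k : Fin 4`
  set c : Fin 4 → Sym2 (Fin 4) := ![s(0, 1), s(1, 2), s(2, 3), s(0, 3)] with hcdef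
  set g : Fin 4 → ℝ := ![t 1 - t 0, t 2 - t 1, t 3 - t 2, 2 * π - (t 3 - t 0)] with hgdef
  have hcC : ∀ z ∈ C, ∃ k, c k = z := by
    intro z hz
    simp only [hCdef, Finset.mem_insert, Finset.mem_singleton] at hz
    rcases hz with rfl | rfl | rfl | rfl
    exacts [⟨0, rfl⟩, ⟨1, rfl⟩, ⟨2, rfl⟩, ⟨3, rfl⟩]
  have hcinj : Function.Injective c := by rw [hcdef]; decide
  have himage : ∀ R : Set (Sym2 (Fin 4)), R ⊆ ↑C →
      R = c '' ↑(Finset.univ.filter fun k => c k ∈ R) := by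
    intro R hR
    ext z
    constructor
    · intro hz
      obtain ⟨k, rfl⟩ := hcC z (hR hz)
      exact ⟨k, by simpa using hz, rfl⟩
    · rintro ⟨k, hk, rfl⟩
      simpa using hk
  have hPcount : P.ncard = (Finset.univ.filter fun k => c k ∈ P).card := by
    conv_lhs => rw [himage P hPC]
    rw [Set.ncard_image_of_injective _ hcinj, Set.ncard_coe_finset]
  have hQcount : Q.ncard = (Finset.univ.filter fun k => c k ∈ Q).card := by
    conv_lhs => rw [himage Q hQC]
    rw [Set.ncard_image_of_injective _ hcinj, Set.ncard_coe_finset]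
  have hQsum : ∑ᶠ z ∈ Q, F z = ∑ k ∈ Finset.univ.filter (fun k => c k ∈ Q), F (c k) := by
    conv_lhs => rw [himage Q hQC]
    rw [finsum_mem_image hcinj.injOn, finsum_mem_coe_finset]
  -- the gaps
  have hsum : g 0 + g 1 + g 2 + g 3 = 2 * π := by
    simp only [hgdef, Matrix.cons_val_zero, Matrix.cons_val_one, Matrix.cons_val]
    ring
  have hglow : ∀ k, arccos (1 / 3) ≤ g k := by
    intro k
    fin_cases k <;>
      simp only [hgdef, Fin.zero_eta, Fin.mk_one, Fin.reduceFinMk, Matrix.cons_val_zero,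
        Matrix.cons_val_one, Matrix.cons_val] <;> linarith
  have hgpos : ∀ k, 0 ≤ g k := fun k => le_trans (arccos_nonneg _) (hglow k)
  have hgle : ∀ k, g k ≤ π := by
    have hk0 : g 0 ≤ π := by
      simp only [hgdef, Matrix.cons_val_zero]; linarith
    have hk1 : g 1 ≤ π := by
      simp only [hgdef, Matrix.cons_val_one, Matrix.cons_val_zero]; linarith
    have hk2 : g 2 ≤ π := by
      simp only [hgdef, Matrix.cons_val]; linarith
    have hk3 : g 3 ≤ π := by
      simp only [hgdef, Matrix.cons_val]; linarith
    intro k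
    fin_cases k
    exacts [hk0, hk1, hk2, hk3]
  have hgcos : ∀ k (i j : Fin 4), c k = s(i, j) → cos (t i - t j) = cos (g k) := by
    intro k i j hk
    fin_cases k <;>
      simp only [hcdef, hgdef, Fin.zero_eta, Fin.mk_one, Fin.reduceFinMk, Matrix.cons_val_zero,
        Matrix.cons_val_one, Matrix.cons_val, Sym2.eq, Sym2.rel_iff'] at hk ⊢
    · rcases hk with ⟨rfl, rfl⟩ | ⟨rfl, rfl⟩
      · exact cos_sub_rev _ _
      · rfl
    · rcases hk with ⟨rfl, rfl⟩ | ⟨rfl, rfl⟩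
      · exact cos_sub_rev _ _
      · rfl
    · rcases hk with ⟨rfl, rfl⟩ | ⟨rfl, rfl⟩
      · exact cos_sub_rev _ _
      · rfl
    · rw [hcw]
      rcases hk with ⟨rfl, rfl⟩ | ⟨rfl, rfl⟩
      · exact cos_sub_rev _ _
      · rfl
  have hcne : ∀ k (i j : Fin 4), c k = s(i, j) → i ≠ j := by
    intro k i j hk hij
    subst hij
    have : (c k).IsDiag := by rw [hk]; exact Sym2.mk_isDiag_iff.2 rfl
    fin_cases k <;> simp [hcdef] at this
  have hPgap : ∀ k, c k ∈ P → g k = arccos (1 / 3) := by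
    intro k hk
    induction hz : c k using Sym2.ind with
    | h i j =>
      rw [hz] at hk
      obtain ⟨-, hcos⟩ := hP i j hk
      rw [hgcos k i j hz] at hcos
      exact eq_arccos_third_of_cos_eq (hgpos k) (hgle k) hcos
  have hQgap : ∀ k, c k ∈ Q → g k = F (c k) := by
    intro k hk
    induction hz : c k using Sym2.ind with
    | h i j =>
      rw [hz] at hk
      rw [hF i j hk, hgcos k i j hz, arccos_cos (hgpos k) (hgle k)]
  have hRgap : ∀ k, c k ∉ P → arccos σ ≤ g k := by
    intro k hk
    induction hz : c k using Sym2.ind with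
    | h i j =>
      rw [hz] at hk
      have hne : i ≠ j := hcne k i j hz
      rcases hC i j hne with h | h
      · exact absurd (hPall i j hne h) hk
      · rw [hgcos k i j hz] at h
        exact arccos_le_of_cos_le (hgpos k) h
  -- pointwise lower bound `ℓ k ≤ g k`
  set ℓ : Fin 4 → ℝ := fun k =>
    if c k ∈ P then arccos (1 / 3) else if c k ∈ Q then F (c k) else arccos σ with hℓ
  have hℓle : ∀ k, ℓ k ≤ g k := by
    intro k
    simp only [hℓ]
    split_ifs with h1 h2
    · exact (hPgap k h1).ge
    · exact (hQgap k h2).ge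
    · exact hRgap k h1
  have htot : ∑ k, g k = 2 * π := by rw [Fin.sum_univ_four]; exact hsum
  have hsumle : ∑ k, ℓ k ≤ 2 * π := htot ▸ Finset.sum_le_sum fun k _ => hℓle k
  -- evaluate `∑ ℓ`
  have hfiltQ : (Finset.univ.filter fun k => ¬c k ∈ P).filter (fun k => c k ∈ Q) =
      Finset.univ.filter fun k => c k ∈ Q := by
    ext k
    simp only [Finset.mem_filter, Finset.mem_univ, true_and]
    exact ⟨fun h => h.2, fun h => ⟨hnotP _ h, h⟩⟩
  set n := ((Finset.univ.filter fun k => ¬c k ∈ P).filter fun k => ¬c k ∈ Q).card with hn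
  have hcount : (Finset.univ.filter fun k => c k ∈ P).card +
      ((Finset.univ.filter fun k => c k ∈ Q).card + n) = 4 := by
    rw [hn, ← hfiltQ, Finset.card_filter_add_card_filter_not,
      Finset.card_filter_add_card_filter_not, Finset.card_univ, Fintype.card_fin]
  have hℓsum : ∑ k, ℓ k = (Finset.univ.filter fun k => c k ∈ P).card * arccos (1 / 3) +
      (∑ k ∈ Finset.univ.filter (fun k => c k ∈ Q), F (c k) + n * arccos σ) := by
    simp only [hℓ]
    rw [Finset.sum_ite, Finset.sum_const, nsmul_eq_mul, Finset.sum_ite, hfiltQ, Finset.sum_const,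
      nsmul_eq_mul]
  have hn' : (n : ℝ) = 4 - P.ncard - Q.ncard := by
    have h := congrArg (fun m : ℕ => (m : ℝ)) hcount
    push_cast at h
    rw [hPcount, hQcount]
    linarith
  rw [hℓsum, ← hPcount, ← hQsum, hn'] at hsumle
  linarith


/-! ### Part B. The corner-sum inequality at an arbitrary node -/

/-- **Hales 2012, Lemma 7/Lemma 9 at an arbitrary node: the corner-sum inequality.**  At a node `v`
of the contact graph of a kissing configuration `S` with `d = deg v` contacts, `p` triangle pairs
and `q` rhombus pairs: `p + q ≤ d`, and
`p · arccos (1/3) + Σ_{rhombus pairs z at v} cornerAngle z + (d − p − q) · α₄ ≤ 2π`,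
`α₄ = arccos (1 − (2h₀)²/6)`.  (The `d` corners at `v` sum to `2π`; triangle and rhombus pairs
are azimuthally consecutive, with corners `α₃` and `cornerAngle z`; each of the `d − p − q` other
corners lies between two consecutive contacts of `v` that are not in contact, hence `≥ 2h₀`
apart, and is `≥ α₄` — Hales's "`p α₃ + q α₄ + r α₅ ≤ 2π`" (proof of Lemma 7, `α₅ = α₄`) with
the rhombus corners kept as they are (Lemma 9, constraint 1: "the angles around each node sum
to `2π`").)  For `p + q = d` this is the inequality half of `IsKissingConfig.corner_sum`; it is
the form needed at the nodes of a pentagon or hexagon in the linear programs of Lemma 9.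
[cite: Hales2012, Lemma 7 (proof) and Lemma 9 (proof, constraints 1–3)] -/
theorem IsKissingConfig.corner_sum_le {S : Set (EuclideanSpace ℝ (Fin 3))}
    (hS : IsKissingConfig S) (v : S) :
    (trianglePairs S v).ncard + (rhombusPairs S v).ncard ≤
        ((contactGraph S).neighborSet v).ncard ∧
      ((trianglePairs S v).ncard : ℝ) * arccos (1 / 3) +
          ∑ᶠ z ∈ rhombusPairs S v, cornerAngle S z +
        (((contactGraph S).neighborSet v).ncard - (trianglePairs S v).ncard -
            (rhombusPairs S v).ncard : ℝ) * arccos (1 - (2 * hales_h0) ^ 2 / 6) ≤ 2 * π := by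
  classical
  obtain ⟨hσ, hκ⟩ := node_type_thresholds
  set σ₀ : ℝ := 1 - (2 * hales_h0) ^ 2 / 6 with hσ₀
  set κ₀ : ℝ := (5 * hales_h0 ^ 2 - 12) / (3 * (4 - hales_h0 ^ 2)) with hκ₀
  set G := contactGraph S with hG
  set N := G.neighborSet v with hN
  have hv : ‖(v : EuclideanSpace ℝ (Fin 3))‖ = 2 := hS.norm_eq v.2
  obtain ⟨b, hb⟩ := exists_orthonormalBasis_third_eq hv
  set θ : S → ℝ := fun u => tangentArg b u with hθ
  have hNdist : ∀ u : S, u ∈ N → dist (u : EuclideanSpace ℝ (Fin 3)) v = 2 := fun u hu => by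
    rw [hN, SimpleGraph.mem_neighborSet, hG, contactGraph_adj] at hu
    rwa [dist_comm]
  haveI : Finite S := hS.finite.to_subtype
  have hNfin : N.Finite := Set.toFinite N
  have hinjN : Set.InjOn θ N := fun u hu w hw h =>
    Subtype.ext (eq_of_tangentArg_eq hv b hb (hS.norm_eq u.2) (hNdist u hu) (hS.norm_eq w.2)
      (hNdist w hw) h)
  have hd4 : N.ncard ≤ 4 := hS.ncard_neighborSet_le_four v
  have hα4π : arccos σ₀ ≤ π := arccos_le_pi _
  have hα40 : 0 ≤ arccos σ₀ := arccos_nonneg _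
  have hπ := pi_pos
  -- facts along an injective enumeration of the neighbours
  have hfacts : ∀ {d : ℕ} (e : Fin d → S), Set.range e = N → Function.Injective e →
      (∀ i j, i ≠ j → cos (θ (e i) - θ (e j)) = 1 / 3 ∨ cos (θ (e i) - θ (e j)) ≤ σ₀) ∧
      (∀ i j, s(i, j) ∈ Sym2.map e ⁻¹' trianglePairs S v →
        i ≠ j ∧ cos (θ (e i) - θ (e j)) = 1 / 3) ∧
      (∀ i j, i ≠ j → cos (θ (e i) - θ (e j)) = 1 / 3 →
        s(i, j) ∈ Sym2.map e ⁻¹' trianglePairs S v) ∧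
      (∀ i j, s(i, j) ∈ Sym2.map e ⁻¹' rhombusPairs S v →
        i ≠ j ∧ κ₀ ≤ cos (θ (e i) - θ (e j)) ∧ cos (θ (e i) - θ (e j)) ≤ σ₀) ∧
      (∀ i j, s(i, j) ∈ Sym2.map e ⁻¹' rhombusPairs S v →
        (fun y => cornerAngle S (Sym2.map e y)) s(i, j) =
          arccos (cos (θ (e i) - θ (e j)))) := by
    intro d e hrange hinj
    have hmemN : ∀ i, e i ∈ N := fun i => hrange ▸ Set.mem_range_self i
    have hdv : ∀ i, dist (e i : EuclideanSpace ℝ (Fin 3)) v = 2 := fun i => hNdist _ (hmemN i)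
    have hn2 : ∀ i, ‖(e i : EuclideanSpace ℝ (Fin 3))‖ = 2 := fun i => hS.norm_eq (e i).2
    have hsepij : ∀ i j, e i ≠ e j → ¬G.Adj (e i) (e j) →
        2 * hales_h0 ≤ dist (e i : EuclideanSpace ℝ (Fin 3)) (e j) := by
      intro i j hne hnadj
      rcases hS.2.2 _ (e i).2 _ (e j).2 with h | h | h
      · exact absurd (Subtype.ext h) hne
      · exact absurd h hnadj
      · exact h
    have hadjv : ∀ i, G.Adj v (e i) := fun i => by
      have h := hmemN i
      rwa [hN, SimpleGraph.mem_neighborSet] at h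
    refine ⟨fun i j hij => ?_, fun i j hij => ?_, fun i j hij hcos => ?_, fun i j hij => ?_,
      fun i j _ => ?_⟩
    · have hne : e i ≠ e j := fun h => hij (hinj h)
      by_cases hadj : G.Adj (e i) (e j)
      · exact Or.inl (cos_tangentArg_sub_eq_third hv b hb (hn2 i) (hdv i) (hn2 j) (hdv j) hadj)
      · exact Or.inr (cos_tangentArg_sub_le_of_separated hv b hb (hn2 i) (hdv i) (hn2 j) (hdv j)
          (hsepij i j hne hadj))
    · rw [Set.mem_preimage, Sym2.map_mk, mk_mem_trianglePairs] at hij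
      obtain ⟨huw, -, -⟩ := hij
      exact ⟨fun h => G.ne_of_adj huw (congrArg e h),
        cos_tangentArg_sub_eq_third hv b hb (hn2 i) (hdv i) (hn2 j) (hdv j) huw⟩
    · rw [Set.mem_preimage, Sym2.map_mk, mk_mem_trianglePairs]
      have hne : e i ≠ e j := fun h => hij (hinj h)
      refine ⟨?_, hadjv i, hadjv j⟩
      by_contra hadj
      have h := cos_tangentArg_sub_le_of_separated hv b hb (hn2 i) (hdv i) (hn2 j) (hdv j)
        (hsepij i j hne hadj)
      rw [hcos] at h
      linarith
    · have hb2 := hS.cos_bounds_of_mem_rhombusPairs hij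
      rw [Set.mem_preimage, Sym2.map_mk, mk_mem_rhombusPairs] at hij
      obtain ⟨hne, -⟩ := hij
      rw [inner_eq_one_add_three_mul_cos hv b hb (hn2 i) (hdv i) (hn2 j) (hdv j)] at hb2
      refine ⟨fun h => hne (congrArg e h), ?_, ?_⟩
      · linarith [hb2.1]
      · linarith [hb2.2]
    · show cornerAngle S (Sym2.map e s(i, j)) = _
      rw [Sym2.map_mk, cornerAngle_mk]
      exact tangentAngle_inner_eq_arccos_cos hv b hb (hn2 i) (hdv i) (hn2 j) (hdv j)
  have htransT : ∀ {d : ℕ} (e : Fin d → S), Set.range e = N → Function.Injective e →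
      (trianglePairs S v).ncard = (Sym2.map e ⁻¹' trianglePairs S v).ncard :=
    fun e hrange hinj => ncard_eq_ncard_preimage_sym2Map hinj fun z hz a ha => by
      rw [hrange]; exact mem_neighborSet_of_mem_trianglePairs hz ha
  have htransR : ∀ {d : ℕ} (e : Fin d → S), Set.range e = N → Function.Injective e →
      (rhombusPairs S v).ncard = (Sym2.map e ⁻¹' rhombusPairs S v).ncard :=
    fun e hrange hinj => ncard_eq_ncard_preimage_sym2Map hinj fun z hz a ha => by
      rw [hrange]; exact mem_neighborSet_of_mem_rhombusPairs hz ha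
  have htransS : ∀ {d : ℕ} (e : Fin d → S), Set.range e = N → Function.Injective e →
      ∑ᶠ z ∈ rhombusPairs S v, cornerAngle S z =
        ∑ᶠ y ∈ Sym2.map e ⁻¹' rhombusPairs S v, cornerAngle S (Sym2.map e y) :=
    fun e hrange hinj => finsum_mem_eq_of_sym2Map hinj (fun z hz a ha => by
      rw [hrange]; exact mem_neighborSet_of_mem_rhombusPairs hz ha) _
  -- case analysis on the degree `d ∈ {0, 1, 2, 3, 4}`
  obtain ⟨d, hdN, hd4'⟩ : ∃ d, N.ncard = d ∧ d ≤ 4 := ⟨_, rfl, hd4⟩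
  obtain ⟨e, hmono, hrange⟩ := exists_sorted_enum θ hNfin hinjN hdN
  have hinj : Function.Injective e := hmono.injective.of_comp
  obtain ⟨hC, hP, hPall, hQ, hF⟩ := hfacts e hrange hinj
  rw [hdN, htransT e hrange hinj, htransR e hrange hinj, htransS e hrange hinj]
  interval_cases d
  · -- no contacts: no pairs
    have hPe : Sym2.map e ⁻¹' trianglePairs S v = ∅ := by
      ext z
      simp only [Set.mem_empty_iff_false, iff_false]
      intro hz
      induction z using Sym2.ind with
      | h i j => exact Fin.elim0 i
    have hQe : Sym2.map e ⁻¹' rhombusPairs S v = ∅ := by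
      ext z
      simp only [Set.mem_empty_iff_false, iff_false]
      intro hz
      induction z using Sym2.ind with
      | h i j => exact Fin.elim0 i
    rw [hPe, hQe]
    simp only [Set.ncard_empty, add_zero, le_refl, Nat.cast_zero, zero_mul, finsum_mem_empty,
      sub_zero, true_and]
    linarith
  · -- one contact: no pairs
    have hPe : Sym2.map e ⁻¹' trianglePairs S v = ∅ := by
      ext z
      simp only [Set.mem_empty_iff_false, iff_false]
      intro hz
      induction z using Sym2.ind with
      | h i j => exact (hP i j hz).1 (Subsingleton.elim i j)
    have hQe : Sym2.map e ⁻¹' rhombusPairs S v = ∅ := by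
      ext z
      simp only [Set.mem_empty_iff_false, iff_false]
      intro hz
      induction z using Sym2.ind with
      | h i j => exact (hQ i j hz).1 (Subsingleton.elim i j)
    rw [hPe, hQe]
    simp only [Set.ncard_empty, add_zero, zero_le, Nat.cast_zero, zero_mul, finsum_mem_empty,
      sub_zero, Nat.cast_one, one_mul, true_and]
    linarith
  · exact sum_le_of_sorted_two (fun i => θ (e i)) _ _ hP
      (fun i j hij => ⟨(hQ i j hij).1, (hQ i j hij).2.2⟩) (by linarith) _
      (fun z hz => by
        induction z using Sym2.ind with
        | h i j =>
          show cornerAngle S (Sym2.map e s(i, j)) ≤ π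
          rw [Sym2.map_mk, cornerAngle_mk, tangentAngle]
          exact arccos_le_pi _)
  · exact_mod_cast sum_le_of_sorted_three hσ hκ (fun i => θ (e i)) hmono
      (neg_pi_lt_tangentArg b _).1 (neg_pi_lt_tangentArg b _).2 hC _ _ hP hPall hQ _ hF
  · exact_mod_cast sum_le_of_sorted_four hσ hκ (fun i => θ (e i)) hmono
      (neg_pi_lt_tangentArg b _).1 (neg_pi_lt_tangentArg b _).2 hC _ _ hP hPall hQ _ hF

/-! ### Part C. The two corner values of a rhombus: `θ₁ + θ₂ = π + arccos ((7 + s + t)/9)` -/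

/-- **The rhombus corner-pair identity (cosine form).**  For inner products `s = ⟪u, w⟫`,
`t = ⟪v, x⟫` of the two diagonal pairs of a rhombus `v, u, x, w` of side `2` on `S²(2)` — related by
`(4 + s)(4 + t) = 16` (`rhombus_inner_mul_eq`) — the corner values `θ₁ = tangentAngle s`,
`θ₂ = tangentAngle t` (`tangentAngle s = arccos ((s − 1)/3)`) satisfy
`cos (θ₁ + θ₂) = −(7 + s + t)/9`.  (Expand `cos (arccos p + arccos q)`; on the curve
`(4 + s)(4 + t) = 16` one has `pq = (1 − 5(s + t))/9` and `(1 − p²)(1 − q²) = (4(2 − s − t)/9)²`.)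
[folklore] -/
theorem cos_tangentAngle_add {s t : ℝ} (h : (4 + s) * (4 + t) = 16) (hs₁ : -2 ≤ s) (hs₂ : s ≤ 4)
    (ht₁ : -2 ≤ t) (ht₂ : t ≤ 4) (hst : s + t ≤ 2) :
    cos (tangentAngle s + tangentAngle t) = -(7 + (s + t)) / 9 := by
  unfold tangentAngle
  rw [cos_arccos_add_arccos (by linarith) (by linarith) (by linarith) (by linarith)]
  have hprod : (1 - ((s - 1) / 3) ^ 2) * (1 - ((t - 1) / 3) ^ 2) = (4 * (2 - (s + t)) / 9) ^ 2 := by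
    linear_combination ((20 - 6 * s - 6 * t + s * t) / 81) * h
  have hsq : √(1 - ((s - 1) / 3) ^ 2) * √(1 - ((t - 1) / 3) ^ 2) = 4 * (2 - (s + t)) / 9 := by
    rw [← Real.sqrt_mul (by nlinarith), hprod, Real.sqrt_sq (by linarith)]
  rw [hsq]
  linear_combination h / 9

/-- **The rhombus corner-pair identity.**  With both corners obtuse (`s, t < 1`):
`tangentAngle s + tangentAngle t = π + arccos ((7 + s + t)/9)`.  In particular the two corner
values of a rhombus of the contact graph sum to more than `π + arccos ((7 + σ)/9)` for any bound
`σ ≥ s + t` — the angle form of the lower bound on the area `2(θ₁ + θ₂) − 2π` of a quadrilateral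
(`sol ≥ 1.3085` in the linear programs [HalesFlyspeck2012], from the main estimate
`τ ≥ d(4) = 0.206`; cf. the proof of Lemma 9), here elementary. [folklore] -/
theorem tangentAngle_add_eq {s t : ℝ} (h : (4 + s) * (4 + t) = 16) (hs₁ : -2 ≤ s) (hs₂ : s < 1)
    (ht₁ : -2 ≤ t) (ht₂ : t < 1) :
    tangentAngle s + tangentAngle t = π + arccos ((7 + (s + t)) / 9) := by
  have hc := cos_tangentAngle_add h hs₁ (by linarith) ht₁ (by linarith) (by linarith)
  have h1 : π / 2 < tangentAngle s := by
    rw [tangentAngle]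
    exact lt_of_not_ge fun h' => by have := arccos_le_pi_div_two.1 h'; linarith
  have h2 : π / 2 < tangentAngle t := by
    rw [tangentAngle]
    exact lt_of_not_ge fun h' => by have := arccos_le_pi_div_two.1 h'; linarith
  have h1' : tangentAngle s ≤ π := arccos_le_pi _
  have h2' : tangentAngle t ≤ π := arccos_le_pi _
  set ψ := tangentAngle s + tangentAngle t - π with hψ
  have hψc : cos ψ = (7 + (s + t)) / 9 := by
    rw [hψ, cos_sub_pi, hc]; ring
  have hψeq : ψ = arccos ((7 + (s + t)) / 9) := by
    rw [← hψc, arccos_cos (by linarith) (by linarith)]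
  linarith

/-- `3/5 ≤ arccos c` whenever `c ≤ 0.82` (as `cos (3/5) ≥ 1 − 0.18 = 0.82`). [folklore] -/
theorem three_fifths_le_arccos {c : ℝ} (hc : c ≤ 41 / 50) : 3 / 5 ≤ arccos c := by
  have h1 : c ≤ cos (3 / 5) := by
    have := one_sub_sq_div_two_le_cos (x := (3 / 5 : ℝ))
    linarith
  have h2 : arccos (cos (3 / 5)) = 3 / 5 := arccos_cos (by norm_num) (by linarith [pi_gt_three])
  rw [← h2]
  exact arccos_le_arccos h1

/-- **The two corner values of a rhombus of the contact graph.**  For a rhombus `v, u, x, w` of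
the contact graph of a kissing configuration (`u, w` contacts of `v` and of `x ≠ v`, with `u, w`
not in contact and `v, x` not in contact), the corner value `cornerAngle {u, w}` (the corner at
`v` and at `x`) and the corner value `cornerAngle {v, x}` (the corner at `u` and at `w`) satisfy
`cornerAngle {u, w} + cornerAngle {v, x} = π + arccos ((7 + ⟪u, w⟫ + ⟪v, x⟫)/9)` with
`0 ≤ ⟪u, w⟫ + ⟪v, x⟫ ≤ 0.21`; hence `cornerAngle {u, w} + cornerAngle {v, x} ≥ π + 3/5`.  This is
the (elementary) content of the quadrilateral area bound `sol ≥ 1.3085` of the linear programs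
of Lemma 9 [HalesFlyspeck2012, `contact.mod`]: the area of the rhombus is `2(θ₁ + θ₂) − 2π`.
[cite: Hales2012, Lemma 9 (proof); folklore] -/
theorem IsKissingConfig.cornerAngle_add_cornerAngle {S : Set (EuclideanSpace ℝ (Fin 3))}
    (hS : IsKissingConfig S) {v u x w : S} (hvu : (contactGraph S).Adj v u)
    (hvw : (contactGraph S).Adj v w) (hxu : (contactGraph S).Adj x u)
    (hxw : (contactGraph S).Adj x w) (huw : u ≠ w) (hxv : x ≠ v)
    (hnuw : ¬(contactGraph S).Adj u w) (hnvx : ¬(contactGraph S).Adj v x) :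
    cornerAngle S s(u, w) + cornerAngle S s(v, x) =
        π + arccos ((7 + (⟪(u : EuclideanSpace ℝ (Fin 3)), w⟫ +
          ⟪(v : EuclideanSpace ℝ (Fin 3)), x⟫)) / 9) ∧
      0 ≤ ⟪(u : EuclideanSpace ℝ (Fin 3)), w⟫ + ⟪(v : EuclideanSpace ℝ (Fin 3)), x⟫ ∧
      ⟪(u : EuclideanSpace ℝ (Fin 3)), w⟫ + ⟪(v : EuclideanSpace ℝ (Fin 3)), x⟫ ≤ 21 / 100 ∧
      π + 3 / 5 ≤ cornerAngle S s(u, w) + cornerAngle S s(v, x) := by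
  rw [contactGraph_adj] at hvu hvw hxu hxw hnuw hnvx
  have hu := hS.norm_eq u.2
  have hw := hS.norm_eq w.2
  have hv := hS.norm_eq v.2
  have hx := hS.norm_eq x.2
  have huw' : (u : EuclideanSpace ℝ (Fin 3)) ≠ w := fun h => huw (Subtype.ext h)
  have hxv' : (x : EuclideanSpace ℝ (Fin 3)) ≠ v := fun h => hxv (Subtype.ext h)
  have hsepuw : 2 * hales_h0 ≤ dist (u : EuclideanSpace ℝ (Fin 3)) w := by
    rcases hS.2.2 _ u.2 _ w.2 with h | h | h
    · exact absurd h huw'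
    · exact absurd h hnuw
    · exact h
  have hsepxv : 2 * hales_h0 ≤ dist (x : EuclideanSpace ℝ (Fin 3)) v := by
    rcases hS.2.2 _ x.2 _ v.2 with h | h | h
    · exact absurd h hxv'
    · exact absurd (by rw [dist_comm]; exact h) hnvx
    · exact h
  set s : ℝ := ⟪(u : EuclideanSpace ℝ (Fin 3)), w⟫ with hs
  set t : ℝ := ⟪(v : EuclideanSpace ℝ (Fin 3)), x⟫ with ht
  -- the rhombus relation `(4 + s)(4 + t) = 16`
  have n4 : ∀ y : EuclideanSpace ℝ (Fin 3), ‖y‖ = 2 → ⟪y, y⟫ = 4 := fun y hy => by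
    rw [real_inner_self_eq_norm_sq, hy]; norm_num
  have hvu' : ⟪(v : EuclideanSpace ℝ (Fin 3)), u⟫ = 2 := by
    rw [real_inner_comm]; exact inner_eq_two_of_dist_eq_two hu hv (by rw [dist_comm]; exact hvu)
  have hvw' : ⟪(v : EuclideanSpace ℝ (Fin 3)), w⟫ = 2 := by
    rw [real_inner_comm]; exact inner_eq_two_of_dist_eq_two hw hv (by rw [dist_comm]; exact hvw)
  have hxu' : ⟪(x : EuclideanSpace ℝ (Fin 3)), u⟫ = 2 := inner_eq_two_of_dist_eq_two hx hu hxu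
  have hxw' : ⟪(x : EuclideanSpace ℝ (Fin 3)), w⟫ = 2 := inner_eq_two_of_dist_eq_two hx hw hxw
  have hR := rhombus_smul_add_eq (n4 _ hv) (n4 _ hu) (n4 _ hx) (n4 _ hw) hvu' hvw' hxu' hxw'
    (Ne.symm hxv') huw'
  have hrel : (4 + s) * (4 + t) = 16 := rhombus_inner_mul_eq (n4 _ hv) hvu' hvw' hR
  -- the ranges of `s` and `t`
  have hsmax : s ≤ 4 - 2 * hales_h0 ^ 2 := inner_le_of_separated hu hw hsepuw
  have htmax : t ≤ 4 - 2 * hales_h0 ^ 2 := by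
    rw [ht, real_inner_comm]
    exact inner_le_of_separated hx hv hsepxv
  have hsmin : (4 * hales_h0 ^ 2 - 8) / (4 - hales_h0 ^ 2) ≤ s :=
    le_inner_of_rhombus hv hu hw hx (by rw [dist_comm]; exact hvu) (by rw [dist_comm]; exact hvw)
      huw' hxv' hsepxv hxu hxw
  have htmin : (4 * hales_h0 ^ 2 - 8) / (4 - hales_h0 ^ 2) ≤ t := by
    -- the same rhombus seen from `u`: contacts `v, x` of `u` and of `w`
    have h := le_inner_of_rhombus (v := (u : EuclideanSpace ℝ (Fin 3))) (u := v) (w := x) (x := w)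
      hu hv hx hw hvu hxu (Ne.symm hxv') (Ne.symm huw')
      (by rw [dist_comm]; exact hsepuw) (by rw [dist_comm]; exact hvw)
      (by rw [dist_comm]; exact hxw)
    exact h
  rw [hales_h0_eq] at hsmax htmax hsmin htmin
  norm_num at hsmax htmax hsmin htmin
  have hs1 : s < 1 := by linarith
  have ht1 : t < 1 := by linarith
  have hs2 : -2 ≤ s := by linarith
  have ht2 : -2 ≤ t := by linarith
  have hsum := tangentAngle_add_eq hrel hs2 hs1 ht2 ht1
  -- `0 ≤ s + t ≤ 0.21`: `(4 + s)(s + t) = s²`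
  have hkey : (4 + s) * (s + t) = s ^ 2 := by linear_combination hrel
  have hσ0 : 0 ≤ s + t := by nlinarith
  have hσ1 : s + t ≤ 21 / 100 := by nlinarith
  refine ⟨?_, hσ0, hσ1, ?_⟩
  · rw [cornerAngle_mk, cornerAngle_mk]
    exact hsum
  · rw [cornerAngle_mk, cornerAngle_mk, hsum]
    have := three_fifths_le_arccos (c := (7 + (s + t)) / 9) (by linarith)
    linarith

/-! ### Part D. Comparisons of the constants -/

/-- `3 · arccos (1/3) = π + arccos (23/27)` (as `cos (3 arccos (1/3)) = −23/27` and
`3 arccos (1/3) ∈ (π, 3π/2)`). [folklore] -/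
theorem three_mul_arccos_third : 3 * arccos (1 / 3) = π + arccos (23 / 27) := by
  have hα1 := pi_div_three_lt_arccos_third
  have hα2 := arccos_third_lt_pi_div_two
  have hc : cos (3 * arccos (1 / 3) - π) = 23 / 27 := by
    rw [cos_sub_pi, cos_three_mul_arccos_third]; norm_num
  have h := arccos_cos (x := 3 * arccos (1 / 3) - π) (by linarith) (by linarith [pi_pos])
  rw [hc] at h
  linarith

/-- `1/2 < arccos (23/27)` (as `cos (1/2) ≥ 1 − 1/8 > 23/27`). [folklore] -/
theorem one_half_lt_arccos : 1 / 2 < arccos (23 / 27) := by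
  have h1 : (23 : ℝ) / 27 < cos (1 / 2) := by
    have := one_sub_sq_div_two_le_cos (x := (1 / 2 : ℝ))
    linarith
  have h2 : arccos (cos (1 / 2)) = 1 / 2 := arccos_cos (by norm_num) (by linarith [pi_gt_three])
  rw [← h2]
  exact arccos_lt_arccos (by norm_num) h1 (cos_le_one _)

/-- `β₄ < 2α₃`: a rhombus corner is smaller than two triangle corners. [cite: Hales2012,
Lemma 7 (proof, table (7))] -/
theorem arccos_kappa_lt_two_mul_arccos_third :
    arccos ((5 * hales_h0 ^ 2 - 12) / (3 * (4 - hales_h0 ^ 2))) < 2 * arccos (1 / 3) := by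
  obtain ⟨-, hκ⟩ := node_type_thresholds
  have h2 : 2 * arccos (1 / 3) = arccos (-7 / 9) := by
    rw [← cos_two_mul_arccos_third, arccos_cos (by linarith [arccos_nonneg (1 / 3 : ℝ)])
      (by linarith [arccos_third_lt_pi_div_two])]
  rw [h2]
  exact arccos_lt_arccos (by norm_num) hκ (by rw [hales_h0_eq]; norm_num)

/-- `α₃ < α₄`: a triangle corner is smaller than a rhombus (or larger) corner.
[cite: Hales2012, Lemma 7 (proof, table (7))] -/
theorem arccos_third_lt_arccos_sigma : arccos (1 / 3) < arccos (1 - (2 * hales_h0) ^ 2 / 6) := by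
  obtain ⟨hσ, -⟩ := node_type_thresholds
  exact arccos_lt_arccos (by rw [hales_h0_eq]; norm_num) (by linarith) (by norm_num)

/-- `π/2 < α₄`: rhombus corners are obtuse. [cite: Hales2012, Lemma 7 (proof, table (7))] -/
theorem pi_div_two_lt_arccos_sigma : π / 2 < arccos (1 - (2 * hales_h0) ^ 2 / 6) := by
  obtain ⟨hσ, -⟩ := node_type_thresholds
  exact lt_of_not_ge fun h => by have := arccos_le_pi_div_two.1 h; linarith

/-! ### Part E. Three consecutive triangle corners: the fourth pair has `⟪u, w⟫ = −14/9` -/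

/-- **Three turns of `α₃`.** If `cos A = cos B = cos C = 1/3` and `cos (A + B) < 1/9`,
`cos (B + C) < 1/9` (the partial turns do not come back), then `cos (A + B + C) = cos 3α₃ =
−23/27`.  (`sin A sin B = 1/9 − cos (A + B) > 0` has square `64/81`, so equals `8/9`; likewise
`sin B sin C = 8/9`, whence `sin A sin C = 8/9` and `cos (A + B + C) = −7/27 − 16/27`.)
[folklore] -/
theorem cos_add_add_eq_of_cos_eq_third {A B C : ℝ} (hA : cos A = 1 / 3) (hB : cos B = 1 / 3)
    (hC : cos C = 1 / 3) (hAB : cos (A + B) < 1 / 9) (hBC : cos (B + C) < 1 / 9) :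
    cos (A + B + C) = -23 / 27 := by
  have sA : sin A ^ 2 = 8 / 9 := by nlinarith [sin_sq_add_cos_sq A]
  have sB : sin B ^ 2 = 8 / 9 := by nlinarith [sin_sq_add_cos_sq B]
  have sC : sin C ^ 2 = 8 / 9 := by nlinarith [sin_sq_add_cos_sq C]
  have hab : cos (A + B) = 1 / 9 - sin A * sin B := by rw [cos_add, hA, hB]; ring
  have hbc : cos (B + C) = 1 / 9 - sin B * sin C := by rw [cos_add, hB, hC]; ring
  have pAB : 0 < sin A * sin B := by linarith
  have pBC : 0 < sin B * sin C := by linarith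
  have eAB : sin A * sin B = 8 / 9 := by
    have h2 : (sin A * sin B) ^ 2 = (8 / 9) ^ 2 := by rw [mul_pow, sA, sB]; norm_num
    nlinarith [h2]
  have eBC : sin B * sin C = 8 / 9 := by
    have h2 : (sin B * sin C) ^ 2 = (8 / 9) ^ 2 := by rw [mul_pow, sB, sC]; norm_num
    nlinarith [h2]
  have eAC : sin A * sin C = 8 / 9 := by
    have h := congrArg₂ (· * ·) eAB eBC
    have h' : sin B ^ 2 * (sin A * sin C) = 8 / 9 * (8 / 9) := by rw [← h]; ring
    rw [sB] at h'
    linarith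
  rw [cos_add, cos_add, sin_add, hA, hB, hC]
  nlinarith [eAB, eBC, eAC]

/-- **Three consecutive triangles at a node.** Let `u, k, l, w` be contacts of the node `v` of a
kissing configuration with `u ~ k ~ l ~ w` in contact (three triangles `{v,u,k}`, `{v,k,l}`,
`{v,l,w}` at `v`) and `u, l` as well as `k, w` not in contact.  Then `⟪u, w⟫ = −14/9`: the tangent
directions at `v` turn by `α₃` three times, so `u, w` make the angle `3α₃` (or `2π − 3α₃`) at `v`,
and `⟪u, w⟫ = 1 + 3 cos 3α₃ = 1 − 23/9`.  (At a node of type `(3, 0, 1)` this is the corner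
`2π − 3α₃` of the large face; cf. the hexagon case in the proof of Lemma 9.) [folklore] -/
theorem IsKissingConfig.inner_eq_of_three_triangles {S : Set (EuclideanSpace ℝ (Fin 3))}
    (hS : IsKissingConfig S) {v u k l w : S} (hvu : (contactGraph S).Adj v u)
    (hvk : (contactGraph S).Adj v k) (hvl : (contactGraph S).Adj v l)
    (hvw : (contactGraph S).Adj v w) (huk : (contactGraph S).Adj u k)
    (hkl : (contactGraph S).Adj k l) (hlw : (contactGraph S).Adj l w) (hul : u ≠ l)
    (hnul : ¬(contactGraph S).Adj u l) (hkw : k ≠ w) (hnkw : ¬(contactGraph S).Adj k w) :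
    ⟪(u : EuclideanSpace ℝ (Fin 3)), w⟫ = -14 / 9 := by
  obtain ⟨hσ, -⟩ := node_type_thresholds
  rw [contactGraph_adj] at hvu hvk hvl hvw huk hkl hlw hnul hnkw
  have hv := hS.norm_eq v.2
  have hu := hS.norm_eq u.2
  have hk := hS.norm_eq k.2
  have hl := hS.norm_eq l.2
  have hw := hS.norm_eq w.2
  obtain ⟨b, hb⟩ := exists_orthonormalBasis_third_eq hv
  have du : dist (u : EuclideanSpace ℝ (Fin 3)) v = 2 := by rw [dist_comm]; exact hvu
  have dk : dist (k : EuclideanSpace ℝ (Fin 3)) v = 2 := by rw [dist_comm]; exact hvk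
  have dl : dist (l : EuclideanSpace ℝ (Fin 3)) v = 2 := by rw [dist_comm]; exact hvl
  have dw : dist (w : EuclideanSpace ℝ (Fin 3)) v = 2 := by rw [dist_comm]; exact hvw
  have hsepul : 2 * hales_h0 ≤ dist (u : EuclideanSpace ℝ (Fin 3)) l := by
    rcases hS.2.2 _ u.2 _ l.2 with h | h | h
    · exact absurd (Subtype.ext h) hul
    · exact absurd h hnul
    · exact h
  have hsepkw : 2 * hales_h0 ≤ dist (k : EuclideanSpace ℝ (Fin 3)) w := by
    rcases hS.2.2 _ k.2 _ w.2 with h | h | h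
    · exact absurd (Subtype.ext h) hkw
    · exact absurd h hnkw
    · exact h
  set A := tangentArg b u - tangentArg b k with hA
  set B := tangentArg b k - tangentArg b l with hB
  set C := tangentArg b l - tangentArg b w with hC
  have cA : cos A = 1 / 3 := cos_tangentArg_sub_eq_third hv b hb hu du hk dk huk
  have cB : cos B = 1 / 3 := cos_tangentArg_sub_eq_third hv b hb hk dk hl dl hkl
  have cC : cos C = 1 / 3 := cos_tangentArg_sub_eq_third hv b hb hl dl hw dw hlw
  have cAB : cos (A + B) < 1 / 9 := by
    have h := cos_tangentArg_sub_le_of_separated hv b hb hu du hl dl hsepul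
    rw [show tangentArg b u - tangentArg b l = A + B by rw [hA, hB]; ring] at h
    have h9 : 1 - (2 * hales_h0) ^ 2 / 6 < 1 / 9 := by linarith
    linarith
  have cBC : cos (B + C) < 1 / 9 := by
    have h := cos_tangentArg_sub_le_of_separated hv b hb hk dk hw dw hsepkw
    rw [show tangentArg b k - tangentArg b w = B + C by rw [hB, hC]; ring] at h
    linarith
  have key := cos_add_add_eq_of_cos_eq_third cA cB cC cAB cBC
  rw [inner_eq_one_add_three_mul_cos hv b hb hu du hw dw,
    show tangentArg b u - tangentArg b w = A + B + C by rw [hA, hB, hC]; ring, key]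
  norm_num

end Literature.Geometry.DiscreteGeometry
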